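import Literature.NumberTheory.Sieve.GoldbachSingularSeriesSum
import Literature.NumberTheory.Sieve.HardyLittlewood
import Mathlib.NumberTheory.ArithmeticFunction.Misc
import HarnessLib

/-!
# The mean value of the Hardy–Littlewood main term `J(N) = 𝔖(N) N`

Support file for the discharge of the named fact `Literature.NumberTheory.Sieve.granville_thm1A` (A. Granville, Funct.
Approx. Comment. Math. 37 (2007), Theorem 1A:
RH `↔ ∑_{N ≤ x, N even} (G(N) − J(N)) ≪ x^{3/2+o(1)}`).
Theorem 1A compares the average of `G` with the average of the main term
`J(N) = 𝔖(N) · N` (`Literature.NumberTheory.Sieve.goldbachHLMain`, `𝔖 = Literature.goldbachSingularSeries`); to pass between it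
and the summatory function `∑_{N ≤ x} G(N) = x²/2 + …` one needs the elementary mean value

* `abs_sum_even_goldbachHLMain_sub_le`:
  `|∑_{N ≤ x, N even} 𝔖(N) N − x²/2| ≤ 6 K₀ (x+1)^{3/2}` for all `x : ℕ`
  (`K₀ = Literature.goldbachWeightConst`), i.e. the singular series has mean value `1`.

## Proof

Write `𝔖(2m) = 2C ∏_{p ∣ m, p>2} (p−1)/(p−2)` (`C = Literature.twinPrimeConst = ∏_{p>2}(1 − (p−1)^{−2})`)
as a divisor sum `2C ∑_{d ∣ m} F(d)` with the multiplicative `F(d) = μ(d)² ∏_{p ∣ d} f(p)`,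
`f(2) = 0`, `f(p) = 1/(p−2)` (`singCoeff`; identity `sum_divisors_singCoeff`, checked on prime
powers). Then
`∑_{N ≤ x, N even} 𝔖(N) N = 4C ∑_{m ≤ x/2} m ∑_{d ∣ m} F(d) = 4C ∑_{d ≤ x/2} F(d) d · K_d(K_d+1)/2`,
`K_d = ⌊x/(2d)⌋` (Mathlib `ArithmeticFunction.sum_Ioc_mul_eq_sum_sum`), and
`|d K_d(K_d+1)/2 − (x/2)²/(2d)| ≤ x/2`. Rankin's trick with the weight `d^{−1/2}`
(`F(d)/√d` is summable, Euler factors `1 + 1/((p−2)√p) ≤ exp(4 p^{−3/2})`, reusing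
`GoldbachSeries.summable_of_prod_primesBelow_le` and `goldbachWeightConst`) bounds both the
error and the tail of `∑_d F(d)/d = ∏_{p>2} (1 + 1/(p(p−2))) = 1/C` (`hasSum_singCoeff_div`, from
Mathlib's Euler product and `Literature.NumberTheory.Sieve.tendsto_twinPrimeConstPartial_holds`), giving the main term
`4C · (x/2)²/2 · (1/C) = x²/2`.

## References

* A. Granville, *Refinements of Goldbach's conjecture, and the generalized Riemann hypothesis*,
  Funct. Approx. Comment. Math. 37 (2007), 159–173, Theorem 1A (the comparison sum `∑ J(2N)`).
* G. H. Hardy, J. E. Littlewood, *Partitio Numerorum III*, Acta Math. 44 (1923) (the singular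
  series `𝔖(N)`).
-/

noncomputable section

open Finset Filter ArithmeticFunction
open scoped ArithmeticFunction.Moebius ArithmeticFunction.zeta Topology

namespace Literature.NumberTheory.Sieve

namespace GoldbachAverage

/-! ### The multiplicative coefficient `F(d) = μ(d)² ∏_{p ∣ d} f(p)` -/

/-- The local factor `f(p) = 1/(p − 2)` for an odd prime `p` and `f(2) = 0`, so that
`∏_{p ∣ N, p > 2} (p−1)/(p−2) = ∏_{p ∣ N} (1 + f(p))`. [folklore] -/
def singFactor (p : ℕ) : ℝ := if p = 2 then 0 else 1 / ((p : ℝ) - 2)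

/-- `f(2) = 0`. [folklore] -/
theorem singFactor_two : singFactor 2 = 0 := if_pos rfl

/-- `f(p) = 1/(p−2)` for `p ≠ 2`. [folklore] -/
theorem singFactor_of_ne_two {p : ℕ} (hp : p ≠ 2) : singFactor p = 1 / ((p : ℝ) - 2) := if_neg hp

/-- `f(p) ≥ 0` at primes. [folklore] -/
theorem singFactor_nonneg {p : ℕ} (hp : p.Prime) : 0 ≤ singFactor p := by
  rcases eq_or_ne p 2 with rfl | h2
  · rw [singFactor_two]
  · rw [singFactor_of_ne_two h2]
    have h3 : 3 ≤ p := lt_of_le_of_ne hp.two_le (Ne.symm h2)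
    have : (3 : ℝ) ≤ p := by exact_mod_cast h3
    have : (0 : ℝ) < (p : ℝ) - 2 := by linarith
    positivity

/-- `F(d) = μ(d)² ∏_{p ∣ d} f(p)`: multiplicative, supported on odd squarefree `d`, with
`F(p) = 1/(p−2)` for odd primes. [folklore] -/
def singCoeff : ArithmeticFunction ℝ :=
  ⟨fun d ↦ (μ d : ℝ) ^ 2 * ∏ p ∈ d.primeFactors, singFactor p, by simp⟩

/-- Unfolding lemma. [folklore] -/
theorem singCoeff_apply (d : ℕ) :
    singCoeff d = (μ d : ℝ) ^ 2 * ∏ p ∈ d.primeFactors, singFactor p := rfl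

/-- `F` is multiplicative. [folklore] -/
theorem isMultiplicative_singCoeff : singCoeff.IsMultiplicative := by
  refine ⟨by simp [singCoeff_apply], fun {m n} hmn ↦ ?_⟩
  rcases Nat.eq_zero_or_pos m with rfl | hm
  · simp [singCoeff_apply]
  rcases Nat.eq_zero_or_pos n with rfl | hn
  · simp [singCoeff_apply]
  rw [singCoeff_apply, singCoeff_apply, singCoeff_apply,
    ArithmeticFunction.isMultiplicative_moebius.map_mul_of_coprime hmn,
    Nat.primeFactors_mul hm.ne' hn.ne', prod_union hmn.disjoint_primeFactors]
  push_cast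
  ring

/-- `F ≥ 0`. [folklore] -/
theorem singCoeff_nonneg (d : ℕ) : 0 ≤ singCoeff d := by
  rw [singCoeff_apply]
  exact mul_nonneg (sq_nonneg _)
    (prod_nonneg fun p hp ↦ singFactor_nonneg (Nat.prime_of_mem_primeFactors hp))

/-- `F(d) = 0` unless `d` is squarefree. [folklore] -/
theorem singCoeff_eq_zero_of_not_squarefree {d : ℕ} (hd : ¬Squarefree d) : singCoeff d = 0 := by
  rw [singCoeff_apply, ArithmeticFunction.moebius_eq_zero_of_not_squarefree hd]
  simp

/-- `F(p) = f(p)` at a prime. [folklore] -/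
theorem singCoeff_prime {p : ℕ} (hp : p.Prime) : singCoeff p = singFactor p := by
  rw [singCoeff_apply, ArithmeticFunction.moebius_apply_prime hp, hp.primeFactors]
  simp

/-- `F(2) = 0`. [folklore] -/
theorem singCoeff_two : singCoeff 2 = 0 := by
  rw [singCoeff_prime Nat.prime_two, singFactor_two]

/-- `F(p) = 1/(p−2)` at an odd prime. [folklore] -/
theorem singCoeff_prime_of_ne_two {p : ℕ} (hp : p.Prime) (h2 : p ≠ 2) :
    singCoeff p = 1 / ((p : ℝ) - 2) := by
  rw [singCoeff_prime hp, singFactor_of_ne_two h2]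

/-- `F(p^i) = 0` for `i ≥ 2`. [folklore] -/
theorem singCoeff_prime_pow {p i : ℕ} (hp : p.Prime) (hi : 2 ≤ i) : singCoeff (p ^ i) = 0 := by
  rw [singCoeff_apply, ArithmeticFunction.moebius_apply_prime_pow hp (by omega),
    if_neg (by omega)]
  simp

/-! ### The divisor-sum expansion of the singular series -/

/-- `R(N) = ∏_{p ∣ N} (1 + f(p))` as a (multiplicative) arithmetic function. [folklore] -/
def singProd : ArithmeticFunction ℝ := prodPrimeFactors fun p ↦ 1 + singFactor p

/-- Unfolding lemma for `singProd` at `N ≠ 0`. [folklore] -/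
theorem singProd_apply {N : ℕ} (hN : N ≠ 0) :
    singProd N = ∏ p ∈ N.primeFactors, (1 + singFactor p) :=
  ArithmeticFunction.prodPrimeFactors_apply hN

/-- **Divisor-sum expansion**: `∑_{d ∣ N} F(d) = ∏_{p ∣ N} (1 + f(p))` for `N ≠ 0` (both sides
are multiplicative; compare on prime powers). [folklore] -/
theorem sum_divisors_singCoeff {N : ℕ} (hN : N ≠ 0) :
    ∑ d ∈ N.divisors, singCoeff d = ∏ p ∈ N.primeFactors, (1 + singFactor p) := by
  have hmul : (singCoeff * ζ : ArithmeticFunction ℝ) = singProd := by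
    refine (ArithmeticFunction.IsMultiplicative.eq_iff_eq_on_prime_powers
      (singCoeff * (ζ : ArithmeticFunction ℝ))
      (isMultiplicative_singCoeff.mul ArithmeticFunction.isMultiplicative_zeta.natCast) singProd
      (ArithmeticFunction.IsMultiplicative.prodPrimeFactors _)).mpr fun p i hp ↦ ?_
    rw [ArithmeticFunction.coe_mul_zeta_apply, Nat.sum_divisors_prime_pow hp]
    rcases Nat.eq_zero_or_pos i with rfl | hi
    · simp [singProd_apply one_ne_zero, isMultiplicative_singCoeff.map_one, Nat.primeFactors_one]
    · rw [singProd_apply (pow_ne_zero i hp.ne_zero), Nat.primeFactors_prime_pow hi.ne' hp,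
        prod_singleton]
      -- `∑_{j ≤ i} F(p^j) = F(1) + F(p)`
      obtain ⟨k, rfl⟩ : ∃ k, i = k + 1 := ⟨i - 1, by omega⟩
      induction k with
      | zero =>
        rw [sum_range_succ, sum_range_one, pow_zero, pow_one, isMultiplicative_singCoeff.map_one,
          singCoeff_prime hp]
      | succ k ih =>
        rw [sum_range_succ, ih (by omega), singCoeff_prime_pow hp (by omega), add_zero]
  have := congrArg (fun f : ArithmeticFunction ℝ ↦ f N) hmul
  simp only [ArithmeticFunction.coe_mul_zeta_apply] at this
  rw [this, singProd_apply hN]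

/-- **`𝔖(N) = 2C ∑_{d ∣ N} F(d)` for even `N ≠ 0`** (`C = twinPrimeConst`): the factors at the
primes `p > 2` are `(p−1)/(p−2) = 1 + f(p)`, and the factor at `p = 2` is `1 + f(2) = 1`.
[folklore] -/
theorem goldbachSingularSeries_eq_sum_divisors {N : ℕ} (hN : N ≠ 0) (heven : Even N) :
    goldbachSingularSeries N = 2 * twinPrimeConst * ∑ d ∈ N.divisors, singCoeff d := by
  rw [goldbachSingularSeries_of_even N heven, sum_divisors_singCoeff hN]
  congr 1
  rw [← prod_filter_mul_prod_filter_not N.primeFactors (fun p ↦ 2 < p)]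
  have h1 : ∏ p ∈ N.primeFactors with ¬2 < p, (1 + singFactor p) = 1 := by
    refine prod_eq_one fun p hp ↦ ?_
    rw [mem_filter] at hp
    have hp2 : p = 2 := le_antisymm (not_lt.mp hp.2) (Nat.prime_of_mem_primeFactors hp.1).two_le
    rw [hp2, singFactor_two, add_zero]
  rw [h1, mul_one]
  refine prod_congr rfl fun p hp ↦ ?_
  rw [mem_filter] at hp
  have hp3 : (3 : ℝ) ≤ p := by exact_mod_cast hp.2
  have hne : (p : ℝ) - 2 ≠ 0 := by linarith
  rw [singFactor_of_ne_two (by omega)]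
  field_simp
  ring

/-! ### Rankin's trick: `F(d)/√d` is summable -/

/-- The Rankin-weighted coefficient `W(d) = F(d)/√d`. [folklore] -/
def singCoeffDivSqrt : ArithmeticFunction ℝ := ⟨fun d ↦ singCoeff d / Real.sqrt d, by simp⟩

/-- Unfolding lemma. [folklore] -/
theorem singCoeffDivSqrt_apply (d : ℕ) : singCoeffDivSqrt d = singCoeff d / Real.sqrt d := rfl

/-- `W` is multiplicative. [folklore] -/
theorem isMultiplicative_singCoeffDivSqrt : singCoeffDivSqrt.IsMultiplicative := by
  refine ⟨?_, fun {m n} hmn ↦ ?_⟩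
  · rw [singCoeffDivSqrt_apply, isMultiplicative_singCoeff.map_one]
    simp
  · rw [singCoeffDivSqrt_apply, singCoeffDivSqrt_apply, singCoeffDivSqrt_apply,
      isMultiplicative_singCoeff.map_mul_of_coprime hmn, Nat.cast_mul,
      Real.sqrt_mul (Nat.cast_nonneg m), div_mul_div_comm]

/-- `W ≥ 0`. [folklore] -/
theorem singCoeffDivSqrt_nonneg (d : ℕ) : 0 ≤ singCoeffDivSqrt d :=
  div_nonneg (singCoeff_nonneg d) (Real.sqrt_nonneg _)

/-- `W(d) = 0` unless `d` is squarefree. [folklore] -/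
theorem singCoeffDivSqrt_eq_zero_of_not_squarefree {d : ℕ} (hd : ¬Squarefree d) :
    singCoeffDivSqrt d = 0 := by
  rw [singCoeffDivSqrt_apply, singCoeff_eq_zero_of_not_squarefree hd, zero_div]

/-- Euler factors of `W`: `1 + W(p) ≤ exp(4 p^{−3/2})` (`W(2) = 0`; for `p ≥ 3`,
`1/((p−2)√p) ≤ 4/p^{3/2}`). [folklore] -/
theorem one_add_singCoeffDivSqrt_prime_le {p : ℕ} (hp : p.Prime) :
    1 + singCoeffDivSqrt p ≤ Real.exp (4 * ((p : ℝ) ^ (3 / 2 : ℝ))⁻¹) := by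
  refine le_trans ?_ (Real.add_one_le_exp _)
  rw [add_comm, add_le_add_iff_right, singCoeffDivSqrt_apply]
  have hp0 : (0 : ℝ) < p := by exact_mod_cast hp.pos
  rcases eq_or_ne p 2 with rfl | h2
  · rw [singCoeff_two, zero_div]
    positivity
  · have h3 : (3 : ℝ) ≤ p := by exact_mod_cast lt_of_le_of_ne hp.two_le (Ne.symm h2)
    have hsqrt : 0 < Real.sqrt p := Real.sqrt_pos.mpr hp0
    have h32 : (p : ℝ) ^ (3 / 2 : ℝ) = p * Real.sqrt p := by
      rw [Real.sqrt_eq_rpow, show (3 / 2 : ℝ) = 1 + 1 / 2 by norm_num, Real.rpow_add hp0,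
        Real.rpow_one]
    rw [singCoeff_prime_of_ne_two hp h2, h32, div_div, one_div, ← one_div, ← div_eq_mul_inv,
      div_le_div_iff₀ (by nlinarith) (by positivity)]
    nlinarith

/-- `∏_{p < N} (1 + W(p)) ≤ K₀ = exp(∑_n 4 n^{−3/2})` (`Literature.NumberTheory.Sieve.goldbachWeightConst`). [folklore] -/
theorem prod_primesBelow_singCoeffDivSqrt_le (N : ℕ) :
    ∏ p ∈ N.primesBelow, (1 + singCoeffDivSqrt p) ≤ goldbachWeightConst := by
  calc ∏ p ∈ N.primesBelow, (1 + singCoeffDivSqrt p)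
      ≤ ∏ p ∈ N.primesBelow, Real.exp (4 * ((p : ℝ) ^ (3 / 2 : ℝ))⁻¹) := by
        refine prod_le_prod (fun p _ ↦ by linarith [singCoeffDivSqrt_nonneg p]) fun p hp ↦ ?_
        exact one_add_singCoeffDivSqrt_prime_le (Nat.mem_primesBelow.mp hp).2
    _ = Real.exp (∑ p ∈ N.primesBelow, 4 * ((p : ℝ) ^ (3 / 2 : ℝ))⁻¹) := (Real.exp_sum _ _).symm
    _ ≤ goldbachWeightConst := by
        refine Real.exp_le_exp.mpr (Summable.sum_le_tsum _ (fun n _ ↦ ?_)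
          GoldbachSeries.summable_four_mul_rpow_inv)
        positivity

/-- **`W` is summable**, with `∑_d F(d)/√d ≤ K₀`. [folklore] -/
theorem summable_singCoeffDivSqrt :
    Summable (fun d ↦ singCoeffDivSqrt d) ∧ ∑' d, singCoeffDivSqrt d ≤ goldbachWeightConst :=
  GoldbachSeries.summable_of_prod_primesBelow_le isMultiplicative_singCoeffDivSqrt
    singCoeffDivSqrt_nonneg (fun _ hd ↦ singCoeffDivSqrt_eq_zero_of_not_squarefree hd)
    prod_primesBelow_singCoeffDivSqrt_le

/-! ### The Euler product `∑_d F(d)/d = 1/C` -/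

/-- `G(d) = F(d)/d`. [folklore] -/
def singCoeffDiv : ArithmeticFunction ℝ := ⟨fun d ↦ singCoeff d / d, by simp⟩

/-- Unfolding lemma. [folklore] -/
theorem singCoeffDiv_apply (d : ℕ) : singCoeffDiv d = singCoeff d / d := rfl

/-- `G` is multiplicative. [folklore] -/
theorem isMultiplicative_singCoeffDiv : singCoeffDiv.IsMultiplicative := by
  refine ⟨?_, fun {m n} hmn ↦ ?_⟩
  · rw [singCoeffDiv_apply, isMultiplicative_singCoeff.map_one]
    simp
  · rw [singCoeffDiv_apply, singCoeffDiv_apply, singCoeffDiv_apply,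
      isMultiplicative_singCoeff.map_mul_of_coprime hmn, Nat.cast_mul, div_mul_div_comm]

/-- `0 ≤ G(d) ≤ W(d)` (`1/d ≤ 1/√d` for `d ≥ 1`). [folklore] -/
theorem singCoeffDiv_nonneg_le (d : ℕ) :
    0 ≤ singCoeffDiv d ∧ singCoeffDiv d ≤ singCoeffDivSqrt d := by
  refine ⟨div_nonneg (singCoeff_nonneg d) d.cast_nonneg, ?_⟩
  rw [singCoeffDiv_apply, singCoeffDivSqrt_apply]
  rcases Nat.eq_zero_or_pos d with rfl | hd
  · simp
  · have hd1 : (1 : ℝ) ≤ d := by exact_mod_cast hd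
    have hsqrt : Real.sqrt d ≤ d := by
      rw [Real.sqrt_le_left (by linarith)]
      nlinarith
    exact div_le_div_of_nonneg_left (singCoeff_nonneg d) (Real.sqrt_pos.mpr (by linarith)) hsqrt

/-- `G` is absolutely summable. [folklore] -/
theorem summable_norm_singCoeffDiv : Summable fun d ↦ ‖singCoeffDiv d‖ := by
  refine Summable.of_nonneg_of_le (fun _ ↦ norm_nonneg _) (fun d ↦ ?_) summable_singCoeffDivSqrt.1
  rw [Real.norm_of_nonneg (singCoeffDiv_nonneg_le d).1]
  exact (singCoeffDiv_nonneg_le d).2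

/-- Local Euler factor of `G`: `∑_e G(p^e) = 1 + G(p)`. [folklore] -/
theorem tsum_singCoeffDiv_prime_pow {p : ℕ} (hp : p.Prime) :
    ∑' e : ℕ, singCoeffDiv (p ^ e) = 1 + singCoeffDiv p := by
  rw [tsum_eq_sum (s := {0, 1})]
  · rw [sum_pair (by norm_num), pow_zero, pow_one, isMultiplicative_singCoeffDiv.map_one]
  · intro e he
    simp only [mem_insert, mem_singleton, not_or] at he
    rw [singCoeffDiv_apply, singCoeff_prime_pow hp (by omega), zero_div]

/-- The partial Euler products `∏_{p ≤ m} (1 + G(p)) = (∏_{2 < p ≤ m} (1 − (p−1)^{−2}))^{−1}`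
(`1 + 1/(p(p−2)) = (p−1)²/(p(p−2))`, and the factor at `2` is `1`). [folklore] -/
theorem prod_primesLE_one_add_singCoeffDiv (m : ℕ) :
    ∏ p ∈ Nat.primesLE m, (1 + singCoeffDiv p) = (twinPrimeConstPartial m)⁻¹ := by
  rw [twinPrimeConstPartial, ← prod_inv_distrib,
    ← prod_filter_mul_prod_filter_not (Nat.primesLE m) (fun p ↦ 2 < p)]
  have h1 : ∏ p ∈ Nat.primesLE m with ¬2 < p, (1 + singCoeffDiv p) = 1 := by
    refine prod_eq_one fun p hp ↦ ?_
    rw [mem_filter] at hp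
    have hpp : p.Prime := (Nat.mem_primesBelow.mp hp.1).2
    have hp2 : p = 2 := le_antisymm (not_lt.mp hp.2) hpp.two_le
    rw [hp2, singCoeffDiv_apply, singCoeff_two, zero_div, add_zero]
  rw [h1, mul_one]
  refine prod_congr rfl fun p hp ↦ ?_
  rw [mem_filter] at hp
  have hpp : p.Prime := (Nat.mem_primesBelow.mp hp.1).2
  have hp3 : (3 : ℝ) ≤ p := by exact_mod_cast hp.2
  rw [singCoeffDiv_apply, singCoeff_prime_of_ne_two hpp (by omega)]
  have h1 : (p : ℝ) - 2 ≠ 0 := by linarith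
  have h2 : (p : ℝ) - 1 ≠ 0 := by linarith
  have h3 : (p : ℝ) ≠ 0 := by linarith
  have h4 : ((p : ℝ) - 1) ^ 2 - 1 ≠ 0 := by nlinarith
  field_simp
  ring

/-- **`∑_d F(d)/d = 1/C`** (`C = twinPrimeConst`), by the Euler product and
`Literature.NumberTheory.Sieve.tendsto_twinPrimeConstPartial_holds`. [folklore] -/
theorem hasSum_singCoeffDiv : HasSum (fun d ↦ singCoeffDiv d) twinPrimeConst⁻¹ := by
  have hs := summable_norm_singCoeffDiv.of_norm
  have T1 : Tendsto (fun m : ℕ ↦ ∏ p ∈ Nat.primesLE m, (1 + singCoeffDiv p)) atTop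
      (𝓝 (∑' d, singCoeffDiv d)) := by
    have E := (isMultiplicative_singCoeffDiv.eulerProduct summable_norm_singCoeffDiv).comp
      (tendsto_add_atTop_nat 1)
    refine E.congr' (Eventually.of_forall fun m ↦ prod_congr rfl fun p hp ↦ ?_)
    exact tsum_singCoeffDiv_prime_pow (Nat.mem_primesBelow.mp hp).2
  have T2 : Tendsto (fun m : ℕ ↦ ∏ p ∈ Nat.primesLE m, (1 + singCoeffDiv p)) atTop
      (𝓝 twinPrimeConst⁻¹) := by
    simp_rw [prod_primesLE_one_add_singCoeffDiv]
    exact tendsto_twinPrimeConstPartial_holds.inv₀ twinPrimeConst_pos_holds.ne'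
  rw [← tendsto_nhds_unique T1 T2]
  exact hs.hasSum

/-! ### The main term as a double sum -/

/-- `m ∑_{d ∣ m} F(d) = (F·id * id)(m)` (Dirichlet convolution). [folklore] -/
theorem pmul_id_mul_id_apply (m : ℕ) :
    (singCoeff.pmul (ArithmeticFunction.id : ArithmeticFunction ℝ) *
        (ArithmeticFunction.id : ArithmeticFunction ℝ)) m = m * ∑ d ∈ m.divisors, singCoeff d := by
  rw [ArithmeticFunction.mul_apply, mul_sum,
    ← Nat.sum_divisorsAntidiagonal fun d _ ↦ (m : ℝ) * singCoeff d]
  refine sum_congr rfl fun x hx ↦ ?_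
  have hx' := (Nat.mem_divisorsAntidiagonal.mp hx).1
  rw [ArithmeticFunction.pmul_apply, ArithmeticFunction.natCoe_apply,
    ArithmeticFunction.natCoe_apply, ArithmeticFunction.id_apply, ArithmeticFunction.id_apply]
  rw [← hx', Nat.cast_mul]
  ring

/-- Gauss: `∑_{1 ≤ e ≤ K} e = K(K+1)/2`. [folklore] -/
theorem sum_Ioc_cast (K : ℕ) : ∑ e ∈ Ioc 0 K, (e : ℝ) = (K : ℝ) * ((K : ℝ) + 1) / 2 := by
  induction K with
  | zero => simp
  | succ K ih =>
    rw [sum_Ioc_succ_top (Nat.zero_le K), ih]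
    push_cast
    ring

/-- Reindexing the even `N ≤ x` as `N = 2m`, `m ≤ x/2`. [folklore] -/
theorem sum_filter_even_range (f : ℕ → ℝ) (x : ℕ) :
    ∑ N ∈ (range (x + 1)).filter Even, f N = ∑ m ∈ range (x / 2 + 1), f (2 * m) := by
  have hset : (range (x + 1)).filter Even = (range (x / 2 + 1)).image (fun m ↦ 2 * m) := by
    ext N
    simp only [mem_filter, mem_range, mem_image]
    constructor
    · rintro ⟨hN, m, rfl⟩
      exact ⟨m, by omega, by omega⟩
    · rintro ⟨m, hm, rfl⟩
      exact ⟨by omega, even_two_mul m⟩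
  rw [hset, sum_image fun a _ b _ h ↦ by omega]

/-- **The main term as a double sum**:
`∑_{N ≤ x, N even} 𝔖(N) N = 4C ∑_{1 ≤ d ≤ x/2} F(d) d · K_d (K_d + 1)/2`, `K_d = ⌊x/2⌋/d`.
[folklore] -/
theorem sum_even_goldbachHLMain_eq (x : ℕ) :
    ∑ N ∈ (range (x + 1)).filter Even, goldbachHLMain N =
      4 * twinPrimeConst * ∑ d ∈ Ioc 0 (x / 2),
        singCoeff d * d * (((x / 2 / d : ℕ) : ℝ) * (((x / 2 / d : ℕ) : ℝ) + 1) / 2) := by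
  set y := x / 2 with hy
  -- reindex and drop `m = 0`
  rw [sum_filter_even_range]
  have h0 : ∑ m ∈ range (y + 1), goldbachHLMain (2 * m) =
      ∑ m ∈ Ioc 0 y, goldbachHLMain (2 * m) := by
    refine (sum_subset (fun m hm ↦ ?_) fun m hm hm' ↦ ?_).symm
    · rw [mem_Ioc] at hm
      exact mem_range.mpr (by omega)
    · have : m = 0 := by
        rw [mem_range] at hm
        rw [mem_Ioc] at hm'
        omega
      simp [this, goldbachHLMain]
  rw [h0]
  -- pointwise: `J(2m) = 4C (F·id * id)(m)`
  have hpt : ∀ m ∈ Ioc 0 y, goldbachHLMain (2 * m) = 4 * twinPrimeConst *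
      (singCoeff.pmul (ArithmeticFunction.id : ArithmeticFunction ℝ) *
        (ArithmeticFunction.id : ArithmeticFunction ℝ)) m := by
    intro m hm
    have hm0 : m ≠ 0 := by rw [mem_Ioc] at hm; omega
    have h2m : 2 * m ≠ 0 := by omega
    rw [goldbachHLMain, goldbachSingularSeries_eq_sum_divisors h2m (even_two_mul m),
      pmul_id_mul_id_apply]
    -- the odd divisor sums of `2m` and `m` agree: compare prime factorisations
    have hdiv : ∑ d ∈ (2 * m).divisors, singCoeff d = ∑ d ∈ m.divisors, singCoeff d := by
      rw [sum_divisors_singCoeff h2m, sum_divisors_singCoeff hm0,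
        Nat.primeFactors_mul two_ne_zero hm0, Nat.prime_two.primeFactors]
      rcases em (2 ∈ m.primeFactors) with h2 | h2
      · rw [show ({2} : Finset ℕ) ∪ m.primeFactors = m.primeFactors from
          union_eq_right.mpr (singleton_subset_iff.mpr h2)]
      · rw [← insert_eq, prod_insert h2, singFactor_two, add_zero, one_mul]
    rw [hdiv]
    push_cast
    ring
  rw [sum_congr rfl hpt, ← mul_sum, ArithmeticFunction.sum_Ioc_mul_eq_sum_sum]
  congr 1
  refine sum_congr rfl fun d _ ↦ ?_
  rw [ArithmeticFunction.pmul_apply, ArithmeticFunction.natCoe_apply, ArithmeticFunction.id_apply]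
  simp_rw [ArithmeticFunction.natCoe_apply, ArithmeticFunction.id_apply]
  rw [sum_Ioc_cast]

/-! ### The mean value estimate -/

/-- The elementary lattice-point estimate: for `1 ≤ d ≤ ⌊x/2⌋` and `K = ⌊x/2⌋/d`,
`|d K(K+1)/2 − (x/2)²/(2d)| ≤ x/2`. [folklore] -/
theorem abs_mul_div_sub_le {x d : ℕ} (hd : d ∈ Ioc 0 (x / 2)) :
    |(d : ℝ) * (((x / 2 / d : ℕ) : ℝ) * (((x / 2 / d : ℕ) : ℝ) + 1) / 2) -
        ((x : ℝ) / 2) ^ 2 / (2 * d)| ≤ (x : ℝ) / 2 := by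
  rw [mem_Ioc] at hd
  obtain ⟨hd0, hdy⟩ := hd
  set K := x / 2 / d with hK
  have hd0' : (0 : ℝ) < d := by exact_mod_cast hd0
  have hdY : (d : ℝ) ≤ (x : ℝ) / 2 := by
    have : ((x / 2 : ℕ) : ℝ) ≤ (x : ℝ) / 2 := Nat.cast_div_le
    exact le_trans (by exact_mod_cast hdy) this
  -- `K ≤ u < K + 1` with `u = x/(2d)`
  set u : ℝ := (x : ℝ) / 2 / d with hu
  have hKu : (K : ℝ) ≤ u := by
    rw [hK, hu]
    calc ((x / 2 / d : ℕ) : ℝ) ≤ ((x / 2 : ℕ) : ℝ) / d := Nat.cast_div_le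
      _ ≤ (x : ℝ) / 2 / d := by
          gcongr
          exact Nat.cast_div_le
  have huK : u < K + 1 := by
    rw [hu, hK, Nat.div_div_eq_div_mul]
    have h := Nat.lt_mul_div_succ x (show 0 < 2 * d by omega)
    have h' : (x : ℝ) < (2 * d : ℕ) * ((x / (2 * d) : ℕ) + 1 : ℝ) := by exact_mod_cast h
    rw [div_div, div_lt_iff₀ (by positivity)]
    push_cast at h' ⊢
    linarith
  have hu0 : 0 ≤ u := by positivity
  have hK0 : (0 : ℝ) ≤ K := Nat.cast_nonneg K
  -- `|K(K+1) − u²| ≤ u + 1`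
  have hmain : |(K : ℝ) * (K + 1) - u ^ 2| ≤ u + 1 := by
    rw [abs_le]
    constructor <;> nlinarith
  have hrew : (d : ℝ) * ((K : ℝ) * ((K : ℝ) + 1) / 2) - ((x : ℝ) / 2) ^ 2 / (2 * d) =
      (d : ℝ) / 2 * ((K : ℝ) * (K + 1) - u ^ 2) := by
    rw [hu]
    field_simp
  rw [hrew, abs_mul, abs_of_pos (by positivity)]
  calc (d : ℝ) / 2 * |(K : ℝ) * (K + 1) - u ^ 2| ≤ (d : ℝ) / 2 * (u + 1) := by gcongr
    _ = ((x : ℝ) / 2 + d) / 2 := by rw [hu]; field_simp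
    _ ≤ (x : ℝ) / 2 := by linarith

/-- **Mean value of the Hardy–Littlewood main term** (the singular series has mean value `1`):
`|∑_{N ≤ x, N even} 𝔖(N) N − x²/2| ≤ 6 K₀ (x+1)^{3/2}` for all `x : ℕ`, with
`K₀ = Literature.goldbachWeightConst`. This is the comparison between Granville's `∑_{2N ≤ x} J(2N)` and
`x²/2` needed to restate Theorem 1A in terms of `∑_{N ≤ x} G(N)`. [folklore] -/
theorem abs_sum_even_goldbachHLMain_sub_le (x : ℕ) :
    |∑ N ∈ (range (x + 1)).filter Even, goldbachHLMain N - (x : ℝ) ^ 2 / 2| ≤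
      6 * goldbachWeightConst * ((x : ℝ) + 1) ^ (3 / 2 : ℝ) := by
  set y := x / 2 with hy
  set Y : ℝ := (x : ℝ) / 2 with hY
  set Wsum : ℝ := ∑' d, singCoeffDivSqrt d with hWsum
  have hW := summable_singCoeffDivSqrt
  have hWsum0 : 0 ≤ Wsum := tsum_nonneg singCoeffDivSqrt_nonneg
  have hWK : Wsum ≤ goldbachWeightConst := hW.2
  have hY0 : 0 ≤ Y := by positivity
  have hyY : (y : ℝ) ≤ Y := Nat.cast_div_le
  have hYy : Y ≤ (y : ℝ) + 1 := by
    have := Nat.lt_mul_div_succ x two_pos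
    have h' : (x : ℝ) < 2 * ((x / 2 : ℕ) + 1 : ℝ) := by exact_mod_cast this
    rw [hY, hy]
    linarith
  have hC0 : 0 < twinPrimeConst := twinPrimeConst_pos_holds
  have hC1 : twinPrimeConst ≤ 1 := twinPrimeConst_le_one
  have hK0 : 0 ≤ goldbachWeightConst := (Real.exp_pos _).le
  rw [sum_even_goldbachHLMain_eq]
  -- Step 1: replace `d K(K+1)/2` by `Y²/(2d)`
  set E1 : ℝ := ∑ d ∈ Ioc 0 y, singCoeff d *
      ((d : ℝ) * (((y / d : ℕ) : ℝ) * (((y / d : ℕ) : ℝ) + 1) / 2) - Y ^ 2 / (2 * d)) with hE1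
  have hsplit : ∑ d ∈ Ioc 0 y, singCoeff d * d * (((y / d : ℕ) : ℝ) * (((y / d : ℕ) : ℝ) + 1) / 2) =
      Y ^ 2 / 2 * ∑ d ∈ Ioc 0 y, singCoeffDiv d + E1 := by
    rw [hE1, mul_sum, ← sum_add_distrib]
    refine sum_congr rfl fun d hd ↦ ?_
    have hd0 : (d : ℝ) ≠ 0 := by
      rw [mem_Ioc] at hd
      exact_mod_cast hd.1.ne'
    rw [singCoeffDiv_apply]
    field_simp
    ring
  have hE1le : |E1| ≤ Y * Real.sqrt Y * Wsum := by
    calc |E1| ≤ ∑ d ∈ Ioc 0 y, |singCoeff d *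
          ((d : ℝ) * (((y / d : ℕ) : ℝ) * (((y / d : ℕ) : ℝ) + 1) / 2) - Y ^ 2 / (2 * d))| :=
          abs_sum_le_sum_abs _ _
      _ ≤ ∑ d ∈ Ioc 0 y, Real.sqrt Y * singCoeffDivSqrt d * Y := by
          refine sum_le_sum fun d hd ↦ ?_
          rw [abs_mul, abs_of_nonneg (singCoeff_nonneg d)]
          have hd' := hd
          rw [mem_Ioc] at hd'
          have hd0 : (0 : ℝ) < d := by exact_mod_cast hd'.1
          have hdY : (d : ℝ) ≤ Y := le_trans (by exact_mod_cast hd'.2) hyY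
          have hF : singCoeff d ≤ Real.sqrt Y * singCoeffDivSqrt d := by
            rw [singCoeffDivSqrt_apply, mul_div_assoc', le_div_iff₀ (Real.sqrt_pos.mpr hd0),
              mul_comm]
            exact mul_le_mul_of_nonneg_right (Real.sqrt_le_sqrt hdY) (singCoeff_nonneg d)
          exact mul_le_mul hF (abs_mul_div_sub_le hd) (abs_nonneg _)
            (mul_nonneg (Real.sqrt_nonneg _) (singCoeffDivSqrt_nonneg d))
      _ = Y * Real.sqrt Y * ∑ d ∈ Ioc 0 y, singCoeffDivSqrt d := by
          rw [mul_sum]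
          exact sum_congr rfl fun d _ ↦ by ring
      _ ≤ Y * Real.sqrt Y * Wsum := by
          gcongr
          exact hW.1.sum_le_tsum _ fun d _ ↦ singCoeffDivSqrt_nonneg d
  -- Step 2: the partial sum of `G` against `1/C`
  have hGs := summable_norm_singCoeffDiv.of_norm
  have hGtot : ∑' d, singCoeffDiv d = twinPrimeConst⁻¹ := hasSum_singCoeffDiv.tsum_eq
  have hIoc : ∑ d ∈ Ioc 0 y, singCoeffDiv d = ∑ d ∈ range (y + 1), singCoeffDiv d := by
    refine sum_subset (fun d hd ↦ ?_) fun d hd hd' ↦ ?_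
    · rw [mem_Ioc] at hd
      exact mem_range.mpr (by omega)
    · have : d = 0 := by
        rw [mem_range] at hd
        rw [mem_Ioc] at hd'
        omega
      simp [this]
  set tail : ℝ := ∑' i, singCoeffDiv (i + (y + 1)) with htail
  have htail_eq : ∑ d ∈ Ioc 0 y, singCoeffDiv d = twinPrimeConst⁻¹ - tail := by
    rw [hIoc, ← hGtot, ← hGs.sum_add_tsum_nat_add (y + 1), htail]
    ring
  have htail0 : 0 ≤ tail := tsum_nonneg fun i ↦ (singCoeffDiv_nonneg_le _).1
  have htail_le : tail ≤ Wsum / Real.sqrt ((y : ℝ) + 1) := by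
    have hsq : 0 < Real.sqrt ((y : ℝ) + 1) := Real.sqrt_pos.mpr (by positivity)
    have hW' : Summable fun i ↦ singCoeffDivSqrt (i + (y + 1)) :=
      (summable_nat_add_iff (y + 1)).mpr hW.1
    have hG' : Summable fun i ↦ singCoeffDiv (i + (y + 1)) := (summable_nat_add_iff (y + 1)).mpr hGs
    calc tail ≤ ∑' i, singCoeffDivSqrt (i + (y + 1)) / Real.sqrt ((y : ℝ) + 1) := by
          refine hG'.tsum_le_tsum (fun i ↦ ?_) (hW'.div_const _)
          have hi : ((y : ℝ) + 1) ≤ ((i + (y + 1) : ℕ) : ℝ) := by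
            push_cast
            linarith [(i.cast_nonneg : (0 : ℝ) ≤ i)]
          have hi0 : (0 : ℝ) < ((i + (y + 1) : ℕ) : ℝ) := by positivity
          rw [singCoeffDiv_apply, singCoeffDivSqrt_apply, div_div]
          refine div_le_div_of_nonneg_left (singCoeff_nonneg _) (by positivity) ?_
          calc Real.sqrt ((i + (y + 1) : ℕ) : ℝ) * Real.sqrt ((y : ℝ) + 1)
              ≤ Real.sqrt ((i + (y + 1) : ℕ) : ℝ) * Real.sqrt ((i + (y + 1) : ℕ) : ℝ) := by
                gcongr
            _ = ((i + (y + 1) : ℕ) : ℝ) := Real.mul_self_sqrt hi0.le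
      _ = (∑' i, singCoeffDivSqrt (i + (y + 1))) / Real.sqrt ((y : ℝ) + 1) := tsum_div_const
      _ ≤ Wsum / Real.sqrt ((y : ℝ) + 1) := by
          gcongr
          rw [hWsum, ← hW.1.sum_add_tsum_nat_add (y + 1)]
          linarith [sum_nonneg fun d (_ : d ∈ range (y + 1)) ↦ singCoeffDivSqrt_nonneg d]
  -- Step 3: assemble
  have hx2 : (x : ℝ) ^ 2 / 2 = 2 * Y ^ 2 := by rw [hY]; ring
  have hkey :
      4 * twinPrimeConst * (Y ^ 2 / 2 * ∑ d ∈ Ioc 0 y, singCoeffDiv d + E1) - (x : ℝ) ^ 2 / 2 =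
      -(2 * twinPrimeConst * Y ^ 2 * tail) + 4 * twinPrimeConst * E1 := by
    rw [htail_eq, hx2]
    have hinv : twinPrimeConst * twinPrimeConst⁻¹ = 1 := mul_inv_cancel₀ hC0.ne'
    linear_combination (2 * Y ^ 2) * hinv
  rw [hsplit, hkey]
  -- `Y²/√(y+1) ≤ Y √Y` and `Y √Y ≤ (x+1)^{3/2}`
  have hYsq : Y ^ 2 * (Wsum / Real.sqrt ((y : ℝ) + 1)) ≤ Y * Real.sqrt Y * Wsum := by
    have hsq : 0 < Real.sqrt ((y : ℝ) + 1) := Real.sqrt_pos.mpr (by positivity)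
    rw [mul_div_assoc', div_le_iff₀ hsq]
    have h1 : Real.sqrt Y * Real.sqrt Y = Y := Real.mul_self_sqrt hY0
    have h2 : Real.sqrt Y ≤ Real.sqrt ((y : ℝ) + 1) := Real.sqrt_le_sqrt hYy
    calc Y ^ 2 * Wsum = Y * (Real.sqrt Y * Real.sqrt Y) * Wsum := by rw [h1]; ring
      _ = Y * Real.sqrt Y * Wsum * Real.sqrt Y := by ring
      _ ≤ Y * Real.sqrt Y * Wsum * Real.sqrt ((y : ℝ) + 1) := by gcongr
  have hY32 : Y * Real.sqrt Y ≤ ((x : ℝ) + 1) ^ (3 / 2 : ℝ) := by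
    have hx0 : (0 : ℝ) < (x : ℝ) + 1 := by positivity
    have hYx : Y ≤ (x : ℝ) + 1 := by rw [hY]; linarith [(x.cast_nonneg : (0 : ℝ) ≤ x)]
    rw [show (3 / 2 : ℝ) = 1 + 1 / 2 by norm_num, Real.rpow_add hx0, Real.rpow_one,
      ← Real.sqrt_eq_rpow]
    gcongr
  calc |-(2 * twinPrimeConst * Y ^ 2 * tail) + 4 * twinPrimeConst * E1|
      ≤ |-(2 * twinPrimeConst * Y ^ 2 * tail)| + |4 * twinPrimeConst * E1| := abs_add_le _ _
    _ = 2 * twinPrimeConst * (Y ^ 2 * tail) + 4 * twinPrimeConst * |E1| := by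
        rw [abs_neg, abs_of_nonneg (mul_nonneg (mul_nonneg (mul_nonneg zero_le_two hC0.le)
          (sq_nonneg _)) htail0), abs_mul, abs_of_nonneg (mul_nonneg (by norm_num) hC0.le)]
        ring
    _ ≤ 2 * 1 * (Y ^ 2 * (Wsum / Real.sqrt ((y : ℝ) + 1))) +
          4 * 1 * (Y * Real.sqrt Y * Wsum) :=
        add_le_add
          (mul_le_mul (by linarith) (mul_le_mul_of_nonneg_left htail_le (sq_nonneg Y))
            (mul_nonneg (sq_nonneg _) htail0) (by norm_num))
          (mul_le_mul (by linarith) hE1le (abs_nonneg _) (by norm_num))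
    _ ≤ 2 * 1 * (Y * Real.sqrt Y * Wsum) + 4 * 1 * (Y * Real.sqrt Y * Wsum) := by
        linarith [hYsq]
    _ = 6 * Wsum * (Y * Real.sqrt Y) := by ring
    _ ≤ 6 * goldbachWeightConst * ((x : ℝ) + 1) ^ (3 / 2 : ℝ) :=
        mul_le_mul (mul_le_mul_of_nonneg_left hWK (by norm_num)) hY32 (by positivity)
          (mul_nonneg (by norm_num) hK0)

end GoldbachAverage

end Literature.NumberTheory.Sieve

end
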